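import Summits.QuantumFields.BalabanUV.T4Continuum.Support.NE3DecomposedRepOfQuadLetter
import Summits.QuantumFields.BalabanUV.T4Continuum.Support.NE3ResidualSliceRepFlat
import HarnessLib

/-!
# T⁴ programme, node NE3, route Π — A-NV «4γ-NV»: THE JUNCTION OF RECORD `decomposedRep_of_quadLetter` (file 4γ, ruling ρ-g26-1 (3))
# FIRES AT THE FLAT DATUM — every binder discharged at zero data, for ANY non-negative letter constants

NE3 formalisation swarm `b2b-balaban-t4-ne3-formalise-*`, LEAF PROVER 03 (gen 12); INTENT HOME/CLAIMS.log l.24928 (X3 PRE-READ of 4γ, probe body §P2).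
The pattern of this cell's A-NV files (`NE3DecomposedRepFlat` p239011, `NE3ResidualSliceRepFlat` p242865): every new hypothesis-consuming END of the
route is exercised at the flat datum, so that it is seen to be non-vacuous and its binder list is seen to be jointly satisfiable.

CONTENT (all [folklore]; 0 sorry; 0 def):
* **`decomposedRep_quadLetter_flat_raw`** — for `L, N ≥ 1` and ANY `C, C₂, c₁, c₂, c₃, c₄ ≥ 0`, the owner's `NE3DecomposedRepOfQuadLetter.decomposedRep_of_quadLetter`
  APPLIED at `W = U_A = U_B = flatCfg`, `u = 1`, `X₀ = Nn = 0`, weight `m = 0`, ceiling `αm = 0`, `α₀ = αN = aN = xW = xA = 0`: the Π-L1♮ leaf by leaf-04's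
  `residualSliceRepT_flat_cavg`; `sq` reads `0 ≤ C²·0`; the local quadratic letter `hφ` reads `‖dirIter … 0 z κ‖ = 0 ≤ C₂·0` (leaf-04's
  `dirIter_flatCfg_zero`); (R1)–(R4) read `0 ≤ cᵢ·(weight)·(dirSq ∕ dirL1 of dirIter … 0)`; `hJ1`, `hρ` are `0 ≤ 1`, `0 ≤ 1∕2`; the window radii vanish by
  `fhol_flatCfg`.  Conclusion: `DecomposedRep flatClass …` with the END's raw letters at zero data.
* **`decomposedRep_quadLetter_flat`** — the same with the letters normalised: `DecomposedRep flatClass L N (j+1) flatCfg flatCfg flatCfg 1 0 0 0 0 0 0 0 0`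
  (leaf-04's `NE3DecomposedRepFlat.decomposedRep_flat` shape at zero sizes, here PRODUCED by the junction of record).

LEAN NOTE.  The 35-binder application is written with every binder as a typed `have`, all implicit data named, and `have key := …; exact key`
(a `refine … ?_` with inline tactic arguments hits the `whnf` heartbeat limit at the declaration header).

HONEST FRAMING.  Non-vacuity of OUR junction at the FLAT datum only — nothing about Bałaban's minimisers; the junction's leaves (Π-L1♮ =
[Balaban1985Variational] Prop 2 TYPE-analogue, the weight + quadratic letter ⟸ (Π-REG-γ∕γ′) + Π-C-3γ, the letters of the linear normal part ⟸ W5∕W6)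
remain HYPOTHESES at every non-flat pair; (P♮)_W's numeric lines, (H∃), T-E_w♯ and NE3 are NOT proved; spine PROVED 0∕9; finite T⁴ rung (B)+1 —
NOT infinite volume, NOT mass gap, NOT `BetaPertH`, NOT Clay.  ABSOLUTE RULE kept (no printed sentence is a hypothesis).  PLACEMENT:
`Summits/QuantumFields/BalabanUV/`.  HONEST DEPENDENCY: continuum YM on T⁴ ⇐ BetaPertH ∧ nine spine estimates (0/9 proved); BetaPertH ⇐ (D1) ∧
(D4) ∧ CAP+tail; G-an2-4 gates asym, D1 and NE2/3/4.
-/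

set_option autoImplicit false

open scoped BigOperators Matrix.Norms.L2Operator
open NormedSpace Finset Set

namespace Summit.QuantumFields.BalabanUV.T4Continuum.NE3DecomposedRepOfQuadLetterFlat

open Literature.MathematicalPhysics.QuantumFieldTheory.Balaban1983to89
open B7Prop1Explicit B7Prop2Explicit MatrixLog
open T4AveragingDeficitWall (IsSkewDir IsUnitaryCfg vary vary_zero_dir curl curlSq dirSq dirL1 fhol)
open T4AveragingDeficitWallBoundary (periodBox)
open AveragingDeficitPeriodicCounting (IsPeriodicDir)
open AveragingDeficitChartCalculus (cavg)
open AveragingDeficitDerivCore (dirL1_nonneg)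
open MinimalActionLevels (perWin)
open MinimalActionSandwich (admissible)
open MinimalActionWitness (flatCfg flatClass flatCfg_mem_admissible fhol_flatCfg)
open NE3TangentCovariantTower (dirIter)
open NE3EndpointChartFlat (cavg_flatCfg)
open NE3ProductPathChart (DecomposedRep)
open NE3ResidualSliceRep (normalPart)
open NE3DecomposedRepOfLinearNormalPart (ResidualSliceRepT)
open NE3DecomposedRepFlat (flatCfg_classes dirIter_flatCfg_zero)
open NE3ResidualSliceRepFlat (residualSliceRepT_flat_cavg normalPart_zero zero_sub_zero_dir)
open NE3DecomposedRepOfQuadLetter (decomposedRep_of_quadLetter)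

noncomputable section

variable {d : ℕ} {n : Type*} [Fintype n] [DecidableEq n] [Nonempty n]

/-! ## The junction of record at the flat datum -/

/-- **4γ FIRES AT THE FLAT DATUM**: for `L, N ≥ 1` and ANY non-negative constants `C, C₂, c₁, c₂, c₃, c₄`, every binder of
`decomposedRep_of_quadLetter` is discharged at `W = U_A = U_B = flatCfg`, `u = 1`, `X₀ = Nn = 0`, weight `m = 0`, `α₀ = αm = αN = aN = xW = xA = 0`;
the conclusion is `DecomposedRep flatClass …` with the raw letters of the END at zero data. [folklore] -/
theorem decomposedRep_quadLetter_flat_raw {L N : ℕ} [NeZero L] (hL : 1 ≤ L) (hN : 1 ≤ N) (j : ℕ) {C C₂ c₁ c₂ c₃ c₄ : ℝ}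
    (hC : 0 ≤ C) (hC₂ : 0 ≤ C₂) (hc₁ : 0 ≤ c₁) (hc₂ : 0 ≤ c₂) (hc₃ : 0 ≤ c₃) (hc₄ : 0 ≤ c₄) :
    DecomposedRep (flatClass (d := d) (n := n)) L N (j + 1) flatCfg flatCfg flatCfg (fun _ => 1)
      (fun y μ => (fun (_ : Site d) (_ : Fin d) => (0 : Matrix n n ℂ)) y μ - (fun (_ : Site d) (_ : Fin d) => (0 : Matrix n n ℂ)) y μ)
      (normalPart (fun _ _ => 0) fun y μ =>
        (fun (_ : Site d) (_ : Fin d) => (0 : Matrix n n ℂ)) y μ - (fun (_ : Site d) (_ : Fin d) => (0 : Matrix n n ℂ)) y μ)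
      ((0 : ℝ) + 0) ((1 + 2048 * ((0 : ℝ) + 0)) * 0)
      ((1 + 2048 * Real.sqrt (16 * d + 1)) * (2 * Real.sqrt (c₁ + c₂) * C₂ * C * ((0 : ℝ) * (L : ℝ) ^ (j + 1))))
      (4 * c₃ * C₂ * C ^ 2
          * ((2 * (0 : ℝ) + 0 + 2 * 0 + 4 * (2048 * ((0 : ℝ) + 0) * 0) + 48 * (0 : ℝ) ^ 2
              + 1300 * (((0 : ℝ) + 0) + (1 + 2048 * ((0 : ℝ) + 0)) * 0) ^ 2) * ((L : ℝ) ^ (j + 1)) ^ 2)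
        + 8192 * d * (4 * c₄ * C₂ * C ^ 2
          * ((2 * (0 : ℝ) + 0 + 2 * 0 + 4 * (2048 * ((0 : ℝ) + 0) * 0) + 48 * (0 : ℝ) ^ 2
              + 1300 * (((0 : ℝ) + 0) + (1 + 2048 * ((0 : ℝ) + 0)) * 0) ^ 2) * ((L : ℝ) ^ (j + 1)) ^ 2)))
      (1806 * (4 * c₄ * C₂ * C ^ 2
          * ((2 * (0 : ℝ) + 0 + 2 * 0 + 4 * (2048 * ((0 : ℝ) + 0) * 0) + 48 * (0 : ℝ) ^ 2
              + 1300 * (((0 : ℝ) + 0) + (1 + 2048 * ((0 : ℝ) + 0)) * 0) ^ 2) * ((L : ℝ) ^ (j + 1)) ^ 2)))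
      (2 * (0 : ℝ) + 0 + 2 * 0 + 4 * (2048 * ((0 : ℝ) + 0) * 0) + 48 * (0 : ℝ) ^ 2
        + 1300 * (((0 : ℝ) + 0) + (1 + 2048 * ((0 : ℝ) + 0)) * 0) ^ 2) := by
  have hWu : IsUnitaryCfg (cavg L (flatCfg (d := d) (n := n))) := by rw [cavg_flatCfg]; exact (flatCfg_classes le_rfl).1
  have hadm : cavg L (flatCfg (d := d) (n := n)) ∈ admissible flatClass L (j + 1) flatCfg := by
    rw [cavg_flatCfg]; exact flatCfg_mem_admissible L (j + 1)
  have hrep : ResidualSliceRepT (d := d) (n := n) L N (j + 1) (cavg L flatCfg) flatCfg (fun _ => 1) (fun _ _ => 0) (fun _ _ => 0) 0 :=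
    residualSliceRepT_flat_cavg hL N (j + 1) le_rfl
  have hdir : dirIter L (j + 1) (cavg L (flatCfg (d := d) (n := n))) (fun _ _ => 0) = 0 := by
    rw [cavg_flatCfg]; exact dirIter_flatCfg_zero hL j
  have hdSq0 : dirSq (fun (_ : Site d) (_ : Fin d) => (0 : Matrix n n ℂ)) (periodBox (d := d) (N * L ^ (j + 1))) = 0 := by
    simp [dirSq]
  have hdL10 : dirL1 (fun (_ : Site d) (_ : Fin d) => (0 : Matrix n n ℂ)) (periodBox (d := d) (N * L ^ (j + 1))) = 0 := by
    simp [dirL1]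
  have hcSq0 : curlSq (cavg L (flatCfg (d := d) (n := n))) (fun (_ : Site d) (_ : Fin d) => (0 : Matrix n n ℂ))
      (periodBox (d := d) (N * L ^ (j + 1))) = 0 := by
    simp [curlSq]
  have hRHS2 : 0 ≤ dirSq (dirIter L (j + 1) (cavg L (flatCfg (d := d) (n := n))) (fun _ _ => 0)) (periodBox (d := d) N) :=
    Finset.sum_nonneg fun _ _ => Finset.sum_nonneg fun _ _ => sq_nonneg _
  have hRHS1 : 0 ≤ dirL1 (dirIter L (j + 1) (cavg L (flatCfg (d := d) (n := n))) (fun _ _ => 0)) (periodBox (d := d) N) :=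
    dirL1_nonneg _ _
  have hM0 : (0 : ℝ) ≤ ((L : ℝ) ^ (j + 1)) ^ d / ((L : ℝ) ^ (j + 1)) ^ 2 := by positivity
  have hM0' : (0 : ℝ) ≤ ((L : ℝ) ^ (j + 1)) ^ d / ((L : ℝ) ^ (j + 1)) ^ 4 := by positivity
  have hM0'' : (0 : ℝ) ≤ ((L : ℝ) ^ (j + 1)) ^ d / (L : ℝ) ^ (j + 1) := by positivity
  -- the binders of 4γ at zero data, each with its literal type
  have hm0 : ∀ (z : Site d) (κ : Fin d), (0 : ℝ) ≤ (fun (_ : Site d) (_ : Fin d) => (0 : ℝ)) z κ := fun _ _ => le_rfl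
  have hsq : ((L : ℝ) ^ (j + 1)) ^ d * ∑ z ∈ periodBox (d := d) N, ∑ κ : Fin d, (fun (_ : Site d) (_ : Fin d) => (0 : ℝ)) z κ ^ 2
      ≤ C ^ 2 * dirSq (fun (_ : Site d) (_ : Fin d) => (0 : Matrix n n ℂ)) (periodBox (d := d) (N * L ^ (j + 1))) := by
    rw [hdSq0]; simp
  have hmα : ∀ (z : Site d) (κ : Fin d), (fun (_ : Site d) (_ : Fin d) => (0 : ℝ)) z κ ≤ 0 := fun _ _ => le_rfl
  have hαm : (0 : ℝ) ≤ 1 / 100 := by norm_num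
  have hφ : ∀ z ∈ periodBox (d := d) N, ∀ κ : Fin d,
      ‖dirIter L (j + 1) (cavg L (flatCfg (d := d) (n := n))) (fun _ _ => 0) z κ‖
        ≤ C₂ * ((L : ℝ) ^ (j + 1) * (fun (_ : Site d) (_ : Fin d) => (0 : ℝ)) z κ) ^ 2 := by
    intro z _ κ
    rw [hdir]; simp
  have hNP : IsPeriodicDir (fun (_ : Site d) (_ : Fin d) => (0 : Matrix n n ℂ)) ((N * L ^ (j + 1) : ℕ) : ℤ) := fun _ _ _ => rfl
  have hNsup : ∀ (y : Site d) (μ : Fin d), ‖(fun (_ : Site d) (_ : Fin d) => (0 : Matrix n n ℂ)) y μ‖ ≤ 0 :=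
    fun _ _ => by rw [norm_zero]
  have hαN : (0 : ℝ) ≤ 1 / 2700 := by norm_num
  have hJ1 : ((0 : ℝ) + 43 * 0) * (L : ℝ) ^ (j + 1) ≤ 1 := by norm_num
  have haN : ∀ p ∈ perWin d (N * L ^ (j + 1)),
      ‖curl (cavg L (flatCfg (d := d) (n := n))) (fun (_ : Site d) (_ : Fin d) => (0 : Matrix n n ℂ)) p‖ ≤ 0 := by
    intro p _; rw [T4AveragingDeficitWall.curl_zero_dir, norm_zero]
  have hR1 : dirSq (fun (_ : Site d) (_ : Fin d) => (0 : Matrix n n ℂ)) (periodBox (d := d) (N * L ^ (j + 1)))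
      ≤ c₁ * (((L : ℝ) ^ (j + 1)) ^ d / ((L : ℝ) ^ (j + 1)) ^ 2)
        * dirSq (dirIter L (j + 1) (cavg L (flatCfg (d := d) (n := n))) (fun _ _ => 0)) (periodBox (d := d) N) := by
    rw [hdSq0]; exact mul_nonneg (mul_nonneg hc₁ hM0) hRHS2
  have hR2 : curlSq (cavg L (flatCfg (d := d) (n := n))) (fun (_ : Site d) (_ : Fin d) => (0 : Matrix n n ℂ))
        (periodBox (d := d) (N * L ^ (j + 1)))
      ≤ c₂ * (((L : ℝ) ^ (j + 1)) ^ d / ((L : ℝ) ^ (j + 1)) ^ 4)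
        * dirSq (dirIter L (j + 1) (cavg L (flatCfg (d := d) (n := n))) (fun _ _ => 0)) (periodBox (d := d) N) := by
    rw [hcSq0]; exact mul_nonneg (mul_nonneg hc₂ hM0') hRHS2
  have hR3 : ∑ p ∈ perWin d (N * L ^ (j + 1)),
        ‖curl (cavg L (flatCfg (d := d) (n := n))) (fun (_ : Site d) (_ : Fin d) => (0 : Matrix n n ℂ)) p‖
      ≤ c₃ * (((L : ℝ) ^ (j + 1)) ^ d / ((L : ℝ) ^ (j + 1)) ^ 2)
        * dirL1 (dirIter L (j + 1) (cavg L (flatCfg (d := d) (n := n))) (fun _ _ => 0)) (periodBox (d := d) N) := by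
    simp only [T4AveragingDeficitWall.curl_zero_dir, norm_zero, Finset.sum_const_zero]
    exact mul_nonneg (mul_nonneg hc₃ hM0) hRHS1
  have hR4 : dirL1 (fun (_ : Site d) (_ : Fin d) => (0 : Matrix n n ℂ)) (periodBox (d := d) (N * L ^ (j + 1)))
      ≤ c₄ * (((L : ℝ) ^ (j + 1)) ^ d / (L : ℝ) ^ (j + 1))
        * dirL1 (dirIter L (j + 1) (cavg L (flatCfg (d := d) (n := n))) (fun _ _ => 0)) (periodBox (d := d) N) := by
    rw [hdL10]; exact mul_nonneg (mul_nonneg hc₄ hM0'') hRHS1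
  have hρ : 2 * (c₁ + c₂) * C₂ ^ 2 * C ^ 2 * ((0 : ℝ) * (L : ℝ) ^ (j + 1)) ^ 2 ≤ 1 / 2 := by norm_num
  have hxW : ∀ p ∈ perWin d (N * L ^ (j + 1)),
      ‖((fhol (cavg L (flatCfg (d := d) (n := n))) p : (Matrix n n ℂ)ˣ) : Matrix n n ℂ) - 1‖ ≤ 0 := by
    intro p _; rw [cavg_flatCfg, fhol_flatCfg, Units.val_one, sub_self, norm_zero]
  have hxA : ∀ p ∈ perWin d (N * L ^ (j + 1)),
      ‖((fhol (vary (cavg L (flatCfg (d := d) (n := n))) (fun _ _ => 0) 1) p : (Matrix n n ℂ)ˣ) : Matrix n n ℂ) - 1‖ ≤ 0 := by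
    intro p _; rw [vary_zero_dir, cavg_flatCfg, fhol_flatCfg, Units.val_one, sub_self, norm_zero]
  have key := decomposedRep_of_quadLetter (𝒞 := flatClass) (L := L) (N := N) hL hN j (V := flatCfg) (UA := flatCfg) (UB := flatCfg)
    hWu hadm (u := fun _ => 1) (X₀ := fun _ _ => 0) (Nn := fun _ _ => 0) (α₀ := 0) hrep
    (m := fun _ _ => 0) (C := C) (C₂ := C₂) (αm := 0) hm0 hC hC₂ hsq hmα le_rfl hαm hφ
    (αN := 0) (aN := 0) (c₁ := c₁) (c₂ := c₂) (c₃ := c₃) (c₄ := c₄) hNP le_rfl hNsup hαN hJ1 haN le_rfl hc₁ hc₂ hc₃ hc₄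
    hR1 hR2 hR3 hR4 hρ (xW := 0) (xA := 0) le_rfl le_rfl hxW hxA
  exact key

/-- **THE SAME WITH THE LETTERS NORMALISED**: tangent datum `0`, normal part `0`, `α = αN = ν = κ₁ = κ₂ = a = 0` — i.e. exactly leaf-04's
`NE3DecomposedRepFlat.decomposedRep_flat` shape at zero sizes, now PRODUCED by the junction of record. [folklore] -/
theorem decomposedRep_quadLetter_flat {L N : ℕ} [NeZero L] (hL : 1 ≤ L) (hN : 1 ≤ N) (j : ℕ) {C C₂ c₁ c₂ c₃ c₄ : ℝ}
    (hC : 0 ≤ C) (hC₂ : 0 ≤ C₂) (hc₁ : 0 ≤ c₁) (hc₂ : 0 ≤ c₂) (hc₃ : 0 ≤ c₃) (hc₄ : 0 ≤ c₄) :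
    DecomposedRep (flatClass (d := d) (n := n)) L N (j + 1) flatCfg flatCfg flatCfg (fun _ => 1)
      (fun _ _ => 0) (fun _ _ => 0) 0 0 0 0 0 0 := by
  have h := decomposedRep_quadLetter_flat_raw (d := d) (n := n) hL hN j hC hC₂ hc₁ hc₂ hc₃ hc₄
  rw [zero_sub_zero_dir, normalPart_zero] at h
  simpa using h

end

end Summit.QuantumFields.BalabanUV.T4Continuum.NE3DecomposedRepOfQuadLetterFlat
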